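import Literature.MathematicalPhysics.QuantumLattice.HubbardWave0RepulsiveProofs
import Literature.MathematicalPhysics.QuantumLattice.HubbardSzSectorLadder
import Literature.MathematicalPhysics.QuantumLattice.HubbardSzSectorMonotone
import Literature.MathematicalPhysics.QuantumLattice.HubbardHalfFilledGroundStateTorus
import HarnessLib

/-!
# Lieb–Mattis ordering of the `S^z` sectors of the half-filled Hubbard model

Family `hubbard` (trunk T-QLATTICE); continues `HubbardHalfFilledSector` /
`HubbardWave0RepulsiveProofs` (Lieb, PRL 62 (1989) 1201, Theorem 2) and is written for the
certified-numerics cell `pub-mbboot` (triplet / spin-gap rows `E(L², S^z = 1) - E₀(L²)` on the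
`4 × 4` torus).

Setting: a finite connected graph `G` on `Λ`, bipartite with colour class `A` (`B = Aᶜ`), hopping
`t ≠ 0`, repulsion `U > 0`, half filling `N = |Λ|`. Write `E(a, b)` for the lowest energy of
`H = hamiltonian G t U` in the coordinate sector `(N↑, N↓) = (a, b)`, `a + b = |Λ|`, i.e. the joint
sector `(|Λ|, S^z = M)`, `M = (a - b)/2` (`H.minEnergyOn (szSector (a + b) ((a - b)/2))`), and
`S₀ = ||B| - |A||/2` for Lieb's ground-state spin. The condition `M ≥ S₀` reads `b ≤ |A|` and
`b ≤ |B|`.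

* `LiebTwo.halfFilled_upDownSector_groundState` — **in every sector `(a, b)`, `a + b = |Λ|`, the
  ground state of `H` is unique** and is Lieb's `Φ(W₀)` with `W₀` positive definite (Lieb's
  Theorem 1 transported by the hole–particle transformation on the down spins: the sector `(a, b)`
  of the repulsive model is the `S^z = 0` sector of an attractive model of `2a` particles; the
  tree's `exists_posDef_groundState` is stated for every `a`, the tree's Theorem-2 assembly used
  it at `a = |Λ|/2` only);
* `LiebTwo.spinPlus_mulVec_toFockN_hw` — for `b ≤ |A|, |B|` the explicit state `Ξ = Φ(D)`,
  `D_αα = (#(α ∩ A))! · (#(α ∖ A))!` (the highest-weight vector `|S_A = |A|/2, S_B = |B|/2; S = M,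
  S^z = M⟩` of the Lieb–Mattis reference system, written in Lieb's coordinates: Marshall sign times
  positive Clebsch–Gordan weights), is annihilated by `S⁺`;
* `LiebTwo.halfFilled_upDownSector_groundState_spinPlus_eq_zero`, `…_spinSq` — hence (overlap
  `⟨Ξ, Φ(W₀)⟩ = Σ_α D_αα (W₀)_αα > 0`, uniqueness) for `b ≤ |A|, |B|` **the sector ground state is a
  highest-weight vector: `S⁺ ψ = 0`, `S² ψ = M(M+1) ψ`**, `M = (a - b)/2` — the lowest state with
  `S^z = M ≥ S₀` has total spin EXACTLY `M`;
* `hubbard_halfFilled_minEnergyOn_szSector_lt_succ` — **strict ordering**: for `S₀ ≤ M ≤ |Λ|/2 - 1`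
  (`1 ≤ b ≤ |A|, |B|`), `E(|Λ|, M) < E(|Λ|, M + 1)` (if equal, `S⁻` of the upper ground state would
  be the lower one, a highest-weight vector, forcing `S⁻ ψ = 0` against injectivity of `S⁻`);
* balanced case `|A| = |B| = n` (`hubbard_halfFilled_balanced_…`): `E₀(2n) = E(2n, 0) < E(2n, 1) <
  E(2n, 2) < ⋯ < E(2n, n)`, and the lowest `S^z = 1` state is a triplet (`S² = 2`) — so the cell's
  `E(L², 1) - E₀(L²)` is the singlet–triplet gap; torus forms `hubbardTorus_…` for
  `fermionTorusGraph 2 L`, `L` even;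
* `minEnergyOn_szSector_mul_le_re_expect_of_spinSq` (any `SU(2)`-invariant fermion `H`, pure
  angular-momentum algebra): a spin-`S` `N`-particle vector lies energetically above `E(N, S^z = S)`
  (each `S^z`-component raises to `S^z = S` with unchanged Rayleigh quotient,
  `sector_form_bound_of_spinSq`; components of weight `|m| > S` vanish), i.e. `E_min(S) ≥ E(N, S)`;
  hence at half filling `E_min(S) = E(|Λ|, S)` for `S ≥ S₀` (`hubbard_halfFilled_minEnergyOn_spinSq_eq`)
  and TASAKI'S STATEMENT LITERALLY: `hubbard_halfFilled_minEnergyOn_spinSq_lt_succ` —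
  `E_min(S) < E_min(S + 1)` for `S₀ ≤ S ≤ |Λ|/2 - 1`, with
  `E_min(S) = H.minEnergyOn (nParticleSubmodule |Λ| ⊓ eigenspace S² (S(S+1)))` (his Definition 2.1);
  balanced and even-torus forms `…_balanced_minEnergyOn_spinSq_lt_succ`,
  `hubbardTorus_minEnergyOn_spinSq_lt_succ`.

## The printed statement and what is formalised

Tasaki states (J. Phys.: Condens. Matter 10 (1998) 4353, §5, the display after Theorem 5.2;
arXiv:cond-mat/9512169 p. 11): under the hypotheses of Lieb's Theorem 2, "by combining Theorem 1
in [Lieb 1989] with the method of [Lieb–Mattis 1962], one can easily prove the inequality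
`E_min(S) < E_min(S + 1)` for any `||A| - |B||/2 ≤ S ≤ |Λ|/2 - 1`", where `E_min(S)` is the lowest
energy among `N`-electron states with `(S_tot)² = S(S+1)` (his Definition 2.1). We prove the
`S^z`-sector form `E(|Λ|, S) < E(|Λ|, S + 1)` together with the identification of the total spin of
the sector ground states (`S² = M(M+1)` on the `S^z = M` ground state, `M ≥ S₀`), the `SU(2)`
translation `E_min(S) = E(|Λ|, S)` for `S ≥ S₀` (raising a spin-`S` state to `S^z = S` preserves its
Rayleigh quotient), and from these the printed inequality for
`E_min(S) = H.minEnergyOn (nParticleSubmodule |Λ| ⊓ eigenspace S² (S(S+1)))`. The proof is Lieb's: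
spin-reflection positivity in each sector (tree: `SpinReflectionPositivity`, `HubbardHalfFilledSector`)
plus the overlap with an explicit positive reference state of known spin, replacing the Lieb–Mattis
comparison Hamiltonian.

## References

* H. Tasaki, *The Hubbard model — an introduction and selected rigorous results*, J. Phys.:
  Condens. Matter 10 (1998) 4353, §5 (inequality after Theorem 5.2). [Tasaki1998]
* E. H. Lieb, *Two theorems on the Hubbard model*, Phys. Rev. Lett. 62 (1989) 1201; Erratum 62
  (1989) 1927 — Theorems 1, 2 and their proofs. [LiebPRL1989]
* E. H. Lieb, D. Mattis, *Ordering energy levels of interacting spin systems*, J. Math. Phys. 3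
  (1962) 749. [LiebMattis1962Ordering]
* S.-Q. Shen, Z.-M. Qiu, G.-S. Tian, Phys. Rev. Lett. 72 (1994) 1280 (the same method).
  [ShenQiuTian1994]
-/

noncomputable section

namespace Literature.MathematicalPhysics.QuantumLattice.LiebTwo

open Matrix Finset LiebThm1
open scoped ComplexOrder

attribute [local simp] Literature.MathematicalPhysics.QuantumLattice.star_jwSign

/-! ### Diagonal states in Lieb's coordinates -/

section Diagonal

variable {Λ : Type*} [LinearOrder Λ] [Fintype Λ]

omit [Fintype Λ] in
/-- The self-sign `π(α) = σ(α, α)` depends only on `#α`: erasing an element multiplies it by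
`(-1)^{#α - 1}`. [folklore] -/
private theorem pairSign_self_erase {γ : Finset Λ} {x : Λ} (hx : x ∈ γ) :
    pairSign (γ.erase x) (γ.erase x) = (-1) ^ (γ.card - 1) * pairSign γ γ := by
  have h := pairSign_self_insert (Finset.notMem_erase x γ)
  rw [insert_erase hx, card_erase_of_mem hx] at h
  rw [h, ← mul_assoc, ← pow_add, ← two_mul, pow_mul]
  norm_num

/-- **Values of a diagonal state `Φ(D)`, `D_αα = f(α)`**: supported on the singly occupied
configurations `α↑ ∪ αᶜ↓` of the sector `N↑ = p`, where it equals the Marshall sign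
`(-1)^{#(α ∩ A)}` times `π(α) f(α)` (the tree's `refState_pairSet` for a general diagonal).
[cite: LiebPRL1989, proof of Theorem 2] -/
theorem toFockN_diagonal_pairSet (A : Finset Λ) (p : ℕ) (f : Finset Λ → ℂ) (α γ : Finset Λ) :
    toFockN A p (diagonal fun β : Config Λ p => f β.1) (pairSet α γ) =
      if α.card = p ∧ γ = αᶜ then (-1) ^ (α ∩ A).card * pairSign α α * f α else 0 := by
  rw [toFockN, toFock_pairSet]
  by_cases h : α.card = p ∧ γ = αᶜ
  · obtain ⟨hn, rfl⟩ := h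
    rw [if_pos ⟨hn, rfl⟩, compl_compl, ← pairSign_mul_kappaSign_diag]
    have : extMatrix p (diagonal fun β : Config Λ p => f β.1) α α = f α := by
      rw [show extMatrix p (diagonal fun β : Config Λ p => f β.1) α α =
          (diagonal fun β : Config Λ p => f β.1) ⟨α, hn⟩ ⟨α, hn⟩ from
        extMatrix_apply_coe p _ ⟨α, hn⟩ ⟨α, hn⟩, diagonal_apply_eq]
    rw [this]
  · rw [if_neg h]
    by_cases hc : α.card = p ∧ γᶜ.card = p
    · have hne : (⟨α, hc.1⟩ : Config Λ p) ≠ ⟨γᶜ, hc.2⟩ := by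
        intro heq
        apply h ⟨hc.1, _⟩
        have := congrArg Subtype.val heq
        simp only at this
        rw [this, compl_compl]
      rw [show extMatrix p (diagonal fun β : Config Λ p => f β.1) α γᶜ =
          (diagonal fun β : Config Λ p => f β.1) ⟨α, hc.1⟩ ⟨γᶜ, hc.2⟩ from
        extMatrix_apply_coe p _ ⟨α, hc.1⟩ ⟨γᶜ, hc.2⟩, diagonal_apply_ne _ hne, mul_zero]
    · rw [extMatrix_apply_of_not p _ hc, mul_zero]

/-- `Φ(W)` (for `W` on `p`-subsets) lies in the coordinate sector `(N↑, N↓) = (p, |Λ| - p)`.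
[cite: LiebPRL1989, proof of Theorem 2] -/
theorem isInSector_toFockN (A : Finset Λ) {p q : ℕ} (hpq : p + q = Fintype.card Λ)
    (W : Matrix (Config Λ p) (Config Λ p) ℂ) : IsInSector p q (toFockN A p W) := by
  intro s hs
  by_contra h
  obtain ⟨h1, h2⟩ := toFockN_apply_ne_zero A p W h
  apply hs
  refine ⟨h1, ?_⟩
  rw [Finset.card_compl] at h2
  have := Finset.card_le_univ (downPart s)
  omega

/-- **Overlap of a diagonal state with Lieb's states**: `⟨Φ(D), Φ(W)⟩ = Σ_α conj(f α) W_αα`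
(unitarity of `Φ`). [cite: LiebPRL1989, eq. (3)] -/
theorem toFockN_diagonal_overlap (A : Finset Λ) (p : ℕ) (f : Finset Λ → ℂ)
    (W : Matrix (Config Λ p) (Config Λ p) ℂ) :
    star (toFockN A p (diagonal fun β : Config Λ p => f β.1)) ⬝ᵥ toFockN A p W =
      ∑ α : Config Λ p, star (f α.1) * W α α := by
  rw [star_toFockN_dotProduct_toFockN, hsInner_apply]
  refine Finset.sum_congr rfl fun α _ => ?_
  rw [Finset.sum_eq_single α]
  · rw [diagonal_apply_eq]
  · intro β _ hβ; rw [diagonal_apply_ne _ (Ne.symm hβ), star_zero, zero_mul]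
  · simp

/-- The overlap of a diagonal state with positive weights and `Φ(W)`, `W` positive definite, is
nonzero ("`W_αα > 0` for all `α`", Lieb's overlap argument of Theorem 1(a)).
[cite: LiebPRL1989, proof of Theorem 1] -/
theorem toFockN_diagonal_overlap_ne_zero (A : Finset Λ) (p : ℕ) [Nonempty (Config Λ p)]
    (f : Finset Λ → ℕ) (hf : ∀ α, 0 < f α) {W : Matrix (Config Λ p) (Config Λ p) ℂ}
    (hW : W.PosDef) :
    star (toFockN A p (diagonal fun β : Config Λ p => ((f β.1 : ℕ) : ℂ))) ⬝ᵥ toFockN A p W ≠ 0 := by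
  rw [toFockN_diagonal_overlap A p (fun α => ((f α : ℕ) : ℂ))]
  have hpos : 0 < ∑ α : Config Λ p, star ((f α.1 : ℕ) : ℂ) * W α α := by
    apply Finset.sum_pos _ Finset.univ_nonempty
    intro α _
    refine mul_pos ?_ hW.diag_pos
    rw [Complex.star_def, Complex.conj_natCast]
    exact_mod_cast hf α.1
  exact hpos.ne'

end Diagonal

/-! ### The highest-weight reference state `D_αα = (#(α ∩ A))! (#(α ∖ A))!` -/

section HighestWeight

variable {Λ : Type*} [LinearOrder Λ] [Fintype Λ]

/-- **`S⁺ Ξ = 0` for the reference state** `Ξ = Φ(D)`, `D_αα = (#(α ∩ A))! · (#(α ∖ A))!` on the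
sector `(N↑, N↓) = (p, q)`, `p + q = |Λ|`, provided `q ≤ |A|` and `q ≤ |Aᶜ|` (i.e.
`S^z = (p - q)/2 ≥ ||A| - |Aᶜ||/2`). In spin language `Ξ = ± |S_A = |A|/2, S_B = |Aᶜ|/2; S = M,
S^z = M⟩`: the coefficient of a configuration with `a` up-spins on `A` and `b` on `Aᶜ`
(`a + b = p`) is `(-1)^a a! b!`, and `S⁺` applied to it at a configuration `γ` of `p + 1` up-spins
(`a' = #(γ ∩ A)`, `b' = #(γ ∖ A)`) gives `(-1)^{a'} [b' · a'! (b'-1)! - a' · (a'-1)! b'!] = 0`; the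
conditions `q ≤ |A|, |Aᶜ|` exclude the configurations `γ ⊆ A` / `γ ⊆ Aᶜ` where one of the two
terms is missing. (Clebsch–Gordan coefficients of a highest-weight state of the Lieb–Mattis reference
system `J 𝐒_A · 𝐒_B`, whose sector ground states have `S = max(|M|, S₀)`: Mattis (2006) §5.10,
eqs. (5.174)–(5.177).) [cite: Mattis2006, §5.10] -/
theorem spinPlus_mulVec_toFockN_hw (A : Finset Λ) {p q : ℕ} (hpq : p + q = Fintype.card Λ)
    (hqA : q ≤ A.card) (hqB : q ≤ Aᶜ.card) :
    spinPlus *ᵥ toFockN A p (diagonal fun β : Config Λ p =>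
        (((β.1 ∩ A).card.factorial * (β.1 \ A).card.factorial : ℕ) : ℂ)) = 0 := by
  classical
  set f : Finset Λ → ℂ := fun α => (((α ∩ A).card.factorial * (α \ A).card.factorial : ℕ) : ℂ)
    with hf
  have hD : (diagonal fun β : Config Λ p =>
      (((β.1 ∩ A).card.factorial * (β.1 \ A).card.factorial : ℕ) : ℂ)) =
      diagonal fun β : Config Λ p => f β.1 := rfl
  rw [hD]
  have hAB := Finset.card_add_card_compl A
  funext s
  rw [Pi.zero_apply, ← pairSet_upPart_downPart s, spinPlus_mulVec_pairSet]
  set γ := upPart s with hγdef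
  set δ := downPart s with hδdef
  by_cases hγ : γ.card = p + 1 ∧ δ = γᶜ
  · obtain ⟨hγc, hδ⟩ := hγ
    have hsd : γ \ δ = γ := by rw [hδ]; exact sdiff_eq_self_of_disjoint disjoint_compl_right
    rw [hsd]
    -- the numbers of up-spins of `γ` on the two sublattices
    set a := (γ ∩ A).card with hadef
    set b := (γ \ A).card with hbdef
    have hab : a + b = p + 1 := by rw [hadef, hbdef, Finset.card_inter_add_card_sdiff, hγc]
    have haA : a ≤ A.card := Finset.card_le_card Finset.inter_subset_right
    have hbB : b ≤ Aᶜ.card := Finset.card_le_card fun z hz => by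
      rw [Finset.mem_compl]; exact (Finset.mem_sdiff.1 hz).2
    obtain ⟨a', ha'⟩ : ∃ a', a = a' + 1 := ⟨a - 1, by omega⟩
    obtain ⟨b', hb'⟩ : ∃ b', b = b' + 1 := ⟨b - 1, by omega⟩
    set c : ℂ := (-1) ^ p * pairSign γ γ with hcdef
    set u : ℂ := (-1) ^ a' * c * ((a'.factorial * (b' + 1).factorial : ℕ) : ℂ) with hudef
    set v : ℂ := (-1) ^ (a' + 1) * c * (((a' + 1).factorial * b'.factorial : ℕ) : ℂ) with hvdef
    have hterm : ∀ x ∈ γ, toFockN A p (diagonal fun β : Config Λ p => f β.1)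
        (pairSet (γ.erase x) (insert x δ)) = if x ∈ A then u else v := by
      intro x hxγ
      have hcard : (γ.erase x).card = p := by rw [card_erase_of_mem hxγ, hγc]; rfl
      have hcompl : insert x δ = (γ.erase x)ᶜ := by rw [hδ, Finset.compl_erase]
      rw [toFockN_diagonal_pairSet, if_pos ⟨hcard, hcompl⟩, pairSign_self_erase hxγ, hγc,
        Nat.add_sub_cancel, hf]
      simp only
      by_cases hxA : x ∈ A
      · rw [if_pos hxA]
        have h1 : (γ.erase x ∩ A).card = a' := by
          rw [Finset.erase_inter, card_erase_of_mem (Finset.mem_inter.2 ⟨hxγ, hxA⟩), ← hadef, ha']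
          rfl
        have h2 : (γ.erase x \ A).card = b' + 1 := by
          rw [Finset.erase_sdiff_comm, Finset.erase_eq_of_notMem (fun h => (Finset.mem_sdiff.1 h).2 hxA),
            ← hbdef, hb']
        rw [h1, h2, hudef, hcdef]
      · rw [if_neg hxA]
        have h1 : (γ.erase x ∩ A).card = a' + 1 := by
          rw [Finset.erase_inter, Finset.erase_eq_of_notMem (fun h => hxA (Finset.mem_inter.1 h).2),
            ← hadef, ha']
        have h2 : (γ.erase x \ A).card = b' := by
          rw [Finset.erase_sdiff_comm, card_erase_of_mem (Finset.mem_sdiff.2 ⟨hxγ, hxA⟩), ← hbdef, hb']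
          rfl
        rw [h1, h2, hvdef, hcdef]
    rw [Finset.sum_congr rfl hterm, sum_ite_mem_eq, ← hadef, ← hbdef, ha', hb', hudef, hvdef]
    push_cast [Nat.factorial_succ]
    ring
  · -- off the support of `S⁺ Ξ`: every term vanishes
    refine Finset.sum_eq_zero fun x hx => ?_
    obtain ⟨hxγ, hxδ⟩ := Finset.mem_sdiff.1 hx
    rw [toFockN_diagonal_pairSet, if_neg]
    rintro ⟨hcard, hcompl⟩
    apply hγ
    have hγc : γ.card = p + 1 := by
      have h1 := card_erase_of_mem hxγ
      have h2 : 0 < γ.card := Finset.card_pos.2 ⟨x, hxγ⟩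
      omega
    refine ⟨hγc, ?_⟩
    rw [Finset.compl_erase] at hcompl
    have hxc : x ∉ γᶜ := fun h => (Finset.mem_compl.1 h) hxγ
    rw [← erase_insert hxδ, hcompl, erase_insert hxc]

end HighestWeight

/-! ### Uniqueness of the ground state in every `S^z` sector at half filling -/

section SectorGroundState

variable {Λ : Type*} [LinearOrder Λ] [Fintype Λ] (G : SimpleGraph Λ) [DecidableRel G.Adj]

/-- **The half-filled Hubbard model has a unique ground state in every sector
`(N↑, N↓) = (p, q)`, `p + q = |Λ|`** (`G` connected and bipartite with colour class `A`, `t ≠ 0`,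
`U > 0`): it is Lieb's `Φ(W₀)` with `W₀` a positive definite `p`-subset matrix, its energy is the
sector energy `E(p, q) = H.minEnergyOn (szSector (p + q) ((p - q)/2))`, and every eigenvector of `H`
in the sector with that eigenvalue is a multiple of it. (Lieb's Theorem 1(b) for the attractive
model obtained by the hole–particle transformation of the down spins — `exists_posDef_groundState`
— glued to the Fock space exactly as in the tree's proof of Theorem 2, which is the case
`p = q = |Λ|/2`.) [cite: LiebPRL1989, Theorems 1 and 2] -/
theorem halfFilled_upDownSector_groundState (hG : G.Connected) (A : Finset Λ)
    (hA : ∀ x y : Λ, G.Adj x y → (x ∈ A ↔ y ∉ A)) {t U : ℝ} (ht : t ≠ 0) (hU : 0 < U)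
    {p q : ℕ} (hpq : p + q = Fintype.card Λ) :
    ∃ W₀ : Matrix (Config Λ p) (Config Λ p) ℂ, W₀.PosDef ∧ toFockN A p W₀ ≠ 0 ∧
      hamiltonian G t U *ᵥ toFockN A p W₀ =
        (((hamiltonian G t U).minEnergyOn (szSector (p + q) (((p : ℝ) - q) / 2)) : ℝ) : ℂ) •
          toFockN A p W₀ ∧
      ∀ ψ : Fock (Orb Λ), IsInSector p q ψ →
        hamiltonian G t U *ᵥ ψ =
          (((hamiltonian G t U).minEnergyOn (szSector (p + q) (((p : ℝ) - q) / 2)) : ℝ) : ℂ) • ψ →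
        ∃ c : ℂ, ψ = c • toFockN A p W₀ := by
  classical
  set H := hamiltonian G t U with hHdef
  set E := H.minEnergyOn (szSector (p + q) (((p : ℝ) - q) / 2)) with hEdef
  have hp : p ≤ Fintype.card Λ := by omega
  have hq : q ≤ Fintype.card Λ := by omega
  obtain ⟨α₀, -, hα₀⟩ : ∃ α₀ : Finset Λ, α₀ ⊆ univ ∧ α₀.card = p :=
    Finset.exists_subset_card_eq (by rwa [Finset.card_univ])
  haveI : Nonempty (Config Λ p) := ⟨⟨α₀, hα₀⟩⟩
  obtain ⟨W₀, hW₀pd, hW₀gs, huniq⟩ := exists_posDef_groundState G hG ht hU p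
  have hT : (liebK G t p).IsHermitian ∧ (liebK G t p).IsSymm :=
    ⟨liebK_conjTranspose t p, liebK_transpose G t p⟩
  set LM := Literature.MathematicalPhysics.QuantumLattice.SpinReflection.liebMatrix (liebK G t p)
    (occInd p) (-U) with hLM
  set e := LM.groundEnergy with he
  set ψ₀ := toFockN A p W₀ with hψ₀def
  -- `Φ` intertwines `H` with Lieb's operator plus `U p`
  have hΦH : ∀ W, H *ᵥ toFockN A p W =
      toFockN A p (Literature.MathematicalPhysics.QuantumLattice.liebOp (liebK G t p)
        (fun x => Literature.MathematicalPhysics.QuantumLattice.SpinReflection.rdiag (occInd p x)) (-U) W) +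
        ((U : ℂ) * p) • toFockN A p W := hamiltonian_mulVec_toFockN G A hA t U p
  -- every sector vector is a `Φ(W)`
  have hsec : ∀ ψ, IsInSector p q ψ → toFockN A p (resMatrix p (ofFock A ψ)) = ψ := by
    intro ψ hψ
    apply toFockN_resMatrix_ofFock
    intro s hs
    have h : (upPart s).card = p ∧ (downPart s).card = q := by
      by_contra h
      exact hs (hψ s h)
    refine ⟨h.1, ?_⟩
    rw [Finset.card_compl, h.2]
    omega
  -- eigenvectors of `H` among the `Φ(W)` are eigenmatrices of Lieb's operator
  have heig : ∀ (W : Matrix (Config Λ p) (Config Λ p) ℂ) (E' : ℝ),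
      H *ᵥ toFockN A p W = ((E' : ℝ) : ℂ) • toFockN A p W →
      LM *ᵥ vec W = ((E' - U * p : ℝ) : ℂ) • vec W := by
    intro W E' h1
    rw [hΦH] at h1
    have h2 : toFockN A p (Literature.MathematicalPhysics.QuantumLattice.liebOp (liebK G t p)
        (fun x => Literature.MathematicalPhysics.QuantumLattice.SpinReflection.rdiag (occInd p x)) (-U) W) =
        toFockN A p (((E' - U * p : ℝ) : ℂ) • W) := by
      rw [toFockN_smul]
      have hc : ((E' - U * p : ℝ) : ℂ) = (E' : ℂ) - (U : ℂ) * p := by push_cast; ring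
      rw [hc, sub_smul]
      exact eq_sub_of_add_eq h1
    have h3 := toFockN_injective A p h2
    rw [hLM, Literature.MathematicalPhysics.QuantumLattice.SpinReflection.liebMatrix_mulVec_vec hT.2, h3,
      vec_smul]
  -- `ψ₀ ≠ 0` is an eigenvector with eigenvalue `e + U p`
  have hW₀ne : W₀ ≠ 0 := by
    intro h
    have := hW₀pd.diag_pos (i := ⟨α₀, hα₀⟩)
    rw [h] at this
    exact lt_irrefl _ this
  have hψ₀ne : ψ₀ ≠ 0 := fun h => hW₀ne (toFockN_injective A p (by rw [← hψ₀def, h, toFockN_zero]))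
  have hliebOpW₀ : Literature.MathematicalPhysics.QuantumLattice.liebOp (liebK G t p)
      (fun x => Literature.MathematicalPhysics.QuantumLattice.SpinReflection.rdiag (occInd p x)) (-U) W₀ =
      (e : ℂ) • W₀ :=
    (Literature.MathematicalPhysics.QuantumLattice.SpinReflection.mem_groundSpace_iff_liebOp hT.2
      (occInd p) (-U) W₀).1 hW₀gs
  have hHψ₀ : H *ᵥ ψ₀ = ((e + U * p : ℝ) : ℂ) • ψ₀ := by
    rw [hψ₀def, hΦH, hliebOpW₀, toFockN_smul, ← add_smul]
    push_cast; rfl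
  -- spectral data of the sector `(p, q)`
  obtain ⟨⟨χ, hχ, hχ0, hHχ⟩, hbd⟩ := upDownSector_groundState G t U (a := p) (b := q) hp hq
  have hle : E ≤ e + U * p := by
    have h1 := hbd ψ₀ (isInSector_toFockN A hpq W₀)
    rw [expect, hHψ₀, dotProduct_smul, smul_eq_mul, Complex.re_ofReal_mul] at h1
    have hpos : 0 < (star ψ₀ ⬝ᵥ ψ₀).re :=
      (Complex.pos_iff.1 (dotProduct_star_self_pos_iff.2 hψ₀ne)).1
    exact le_of_mul_le_mul_right h1 hpos
  have hge : e + U * p ≤ E := by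
    set W := resMatrix p (ofFock A χ) with hWdef
    have hχW : toFockN A p W = χ := hsec χ hχ
    have hLMW := heig W E (by rw [hχW]; exact hHχ)
    have hW0 : vec W ≠ 0 := by
      intro h
      rw [← vec_zero, vec_inj] at h
      exact hχ0 (by rw [← hχW, h, toFockN_zero])
    obtain ⟨c, -, hc1⟩ := Literature.MathematicalPhysics.QuantumLattice.exists_smul_unit hW0
    have h := Matrix.groundEnergy_le_rayleigh_holds
      (Literature.MathematicalPhysics.QuantumLattice.SpinReflection.liebMatrix_isHermitian hT.1 (occInd p) (-U))
      (c • vec W) hc1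
    rw [mulVec_smul, ← hLM, hLMW, smul_comm, dotProduct_smul, hc1, smul_eq_mul, mul_one,
      Complex.ofReal_re] at h
    change e ≤ E - U * p at h
    linarith
  have hE : E = e + U * p := le_antisymm hle hge
  refine ⟨W₀, hW₀pd, hψ₀ne, by rw [hHψ₀, hE], fun ψ hψ hHψ => ?_⟩
  set W := resMatrix p (ofFock A ψ) with hWdef
  have hψW : toFockN A p W = ψ := hsec ψ hψ
  have hLMW := heig W E (by rw [hψW]; exact hHψ)
  rw [hE, show ((e + U * p - U * p : ℝ) : ℂ) = (e : ℂ) by push_cast; ring] at hLMW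
  have hgs : vec W ∈ LM.groundSpace := (Matrix.mem_groundSpace_iff _ _).2 hLMW
  obtain ⟨c, hc⟩ := huniq _ hgs
  refine ⟨c, ?_⟩
  have hWc : W = c • W₀ := vec_inj.1 (by rw [hc, vec_smul])
  rw [← hψW, hWc, toFockN_smul]

/-- **The sector ground state is a highest-weight vector when `S^z ≥ S₀`.** Under Lieb's
hypotheses, in the sector `(N↑, N↓) = (p, q)`, `p + q = |Λ|`, with `q ≤ |A|` and `q ≤ |Aᶜ|`
(`M = (p - q)/2 ≥ ||A| - |Aᶜ||/2`), every ground state `ψ` of the sector satisfies `S⁺ ψ = 0`.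
(Uniqueness makes `S⁻S⁺ψ` a multiple `c ψ`; the overlap with the reference state `Ξ`, `S⁺Ξ = 0`,
`⟨Ξ, ψ⟩ ≠ 0`, gives `c = 0`, whence `‖S⁺ψ‖² = ⟨ψ, S⁻S⁺ψ⟩ = 0`.) Tasaki (1998) §5 (after
Thm 5.2); Lieb, PRL 62 (1989) 1201, proof of Theorem 1(a). [cite: Tasaki1998, §5] -/
theorem halfFilled_upDownSector_groundState_spinPlus_eq_zero (hG : G.Connected) (A : Finset Λ)
    (hA : ∀ x y : Λ, G.Adj x y → (x ∈ A ↔ y ∉ A)) {t U : ℝ} (ht : t ≠ 0) (hU : 0 < U)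
    {p q : ℕ} (hpq : p + q = Fintype.card Λ) (hqA : q ≤ A.card) (hqB : q ≤ Aᶜ.card)
    {ψ : Fock (Orb Λ)} (hψ : IsInSector p q ψ)
    (hHψ : hamiltonian G t U *ᵥ ψ =
      (((hamiltonian G t U).minEnergyOn (szSector (p + q) (((p : ℝ) - q) / 2)) : ℝ) : ℂ) • ψ) :
    spinPlus *ᵥ ψ = 0 := by
  classical
  obtain ⟨W₀, hW₀pd, hψ₀ne, hHψ₀, huniq⟩ := halfFilled_upDownSector_groundState G hG A hA ht hU hpq
  set H := hamiltonian G t U with hHdef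
  set E := H.minEnergyOn (szSector (p + q) (((p : ℝ) - q) / 2)) with hEdef
  set ψ₀ := toFockN A p W₀ with hψ₀def
  suffices h0 : spinPlus *ᵥ ψ₀ = 0 by
    obtain ⟨c, rfl⟩ := huniq ψ hψ hHψ
    rw [mulVec_smul, h0, smul_zero]
  have hψ₀sec : IsInSector p q ψ₀ := isInSector_toFockN A hpq W₀
  cases q with
  | zero => exact raisesSpin_spinPlus.mulVec_eq_zero hψ₀sec
  | succ q' =>
    obtain ⟨α₀, -, hα₀⟩ : ∃ α₀ : Finset Λ, α₀ ⊆ univ ∧ α₀.card = p :=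
      Finset.exists_subset_card_eq (by rw [Finset.card_univ]; omega)
    haveI : Nonempty (Config Λ p) := ⟨⟨α₀, hα₀⟩⟩
    -- the reference state
    set Ξ := toFockN A p (diagonal fun β : Config Λ p =>
      (((β.1 ∩ A).card.factorial * (β.1 \ A).card.factorial : ℕ) : ℂ)) with hΞdef
    have hΞP : spinPlus *ᵥ Ξ = 0 := spinPlus_mulVec_toFockN_hw A hpq hqA hqB
    have hov : star Ξ ⬝ᵥ ψ₀ ≠ 0 :=
      toFockN_diagonal_overlap_ne_zero A p
        (fun α => (α ∩ A).card.factorial * (α \ A).card.factorial)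
        (fun α => Nat.mul_pos (Nat.factorial_pos _) (Nat.factorial_pos _)) hW₀pd
    -- `η = S⁻S⁺ψ₀` is again a sector ground state, hence `c ψ₀`
    set η := Literature.MathematicalPhysics.QuantumLattice.spinMinus *ᵥ (spinPlus *ᵥ ψ₀) with hηdef
    have hηsec : IsInSector p (q' + 1) η :=
      lowersSpin_spinMinus.isInSector_mulVec (raisesSpin_spinPlus.isInSector_mulVec hψ₀sec)
    have hHP : H *ᵥ (spinPlus *ᵥ ψ₀) = (E : ℂ) • (spinPlus *ᵥ ψ₀) := by
      rw [mulVec_mulVec, hHdef, (hamiltonian_commute_spinPlus G t U).eq, ← mulVec_mulVec, ← hHdef,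
        hHψ₀, mulVec_smul]
    have hHη : H *ᵥ η = (E : ℂ) • η := by
      rw [hηdef, mulVec_mulVec, hHdef, (hamiltonian_commute_spinMinus G t U).eq, ← mulVec_mulVec,
        ← hHdef, hHP, mulVec_smul]
    obtain ⟨c, hc⟩ := huniq η hηsec hHη
    have hov0 : star Ξ ⬝ᵥ η = 0 := by
      rw [hηdef, ← isSu2Triple_spin.star_P_mulVec_dotProduct, hΞP, star_zero, zero_dotProduct]
    rw [hc, dotProduct_smul, smul_eq_mul, mul_eq_zero] at hov0
    have hc0 : c = 0 := hov0.resolve_right hov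
    have hη0 : η = 0 := by rw [hc, hc0, zero_smul]
    have hnorm : star (spinPlus *ᵥ ψ₀) ⬝ᵥ (spinPlus *ᵥ ψ₀) = 0 := by
      rw [isSu2Triple_spin.star_P_mulVec_dotProduct, ← hηdef, hη0, dotProduct_zero]
    exact dotProduct_star_self_eq_zero.1 hnorm

/-- **The total spin of the sector ground state is `M = (p - q)/2`** (same hypotheses):
`S² ψ = M(M + 1) ψ` — from `S⁺ψ = 0`, `S^z ψ = M ψ` and `S² = (S^z)² + S^z + S⁻S⁺`.
Tasaki (1998) §5 (after Thm 5.2). [cite: Tasaki1998, §5] -/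
theorem halfFilled_upDownSector_groundState_spinSq (hG : G.Connected) (A : Finset Λ)
    (hA : ∀ x y : Λ, G.Adj x y → (x ∈ A ↔ y ∉ A)) {t U : ℝ} (ht : t ≠ 0) (hU : 0 < U)
    {p q : ℕ} (hpq : p + q = Fintype.card Λ) (hqA : q ≤ A.card) (hqB : q ≤ Aᶜ.card)
    {ψ : Fock (Orb Λ)} (hψ : IsInSector p q ψ)
    (hHψ : hamiltonian G t U *ᵥ ψ =
      (((hamiltonian G t U).minEnergyOn (szSector (p + q) (((p : ℝ) - q) / 2)) : ℝ) : ℂ) • ψ) :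
    spinSq *ᵥ ψ = (((((p : ℝ) - q) / 2) * (((p : ℝ) - q) / 2 + 1) : ℝ) : ℂ) • ψ := by
  have hP := halfFilled_upDownSector_groundState_spinPlus_eq_zero G hG A hA ht hU hpq hqA hqB hψ hHψ
  have hZ : HubbardWave0.spinZ *ᵥ ψ = ((1 / 2 : ℂ) * ((p : ℂ) - (q : ℂ))) • ψ :=
    spinZ_mulVec_of_isInSector hψ
  rw [← su2Casimir_spin_eq_spinSq, isSu2Triple_spin.su2Casimir_eq, add_mulVec, add_mulVec,
    ← mulVec_mulVec, ← mulVec_mulVec, hP, mulVec_zero, add_zero, hZ, mulVec_smul, hZ, smul_smul,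
    ← add_smul]
  congr 1
  push_cast; ring

end SectorGroundState

end Literature.MathematicalPhysics.QuantumLattice.LiebTwo

/-! ### Strict ordering of the sector energies -/

namespace Literature.MathematicalPhysics.QuantumLattice

open Matrix Finset
open scoped ComplexOrder

section Ordering

variable {Λ : Type*} [LinearOrder Λ] [Fintype Λ] (G : SimpleGraph Λ) [DecidableRel G.Adj]

/-- **Lieb–Mattis ordering at half filling, coordinate form.** Under Lieb's hypotheses
(`G` connected, bipartite with colour class `A`, `t ≠ 0`, `U > 0`), for the sectors
`(N↑, N↓) = (p, q + 1)` and `(p + 1, q)` of the `|Λ| = p + q + 1`-electron (half-filled) Hubbard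
model with `q + 1 ≤ |A|` and `q + 1 ≤ |Aᶜ|` (i.e. `S^z = (p - q - 1)/2 ≥ S₀ = ||A| - |Aᶜ||/2`):
`E(p, q + 1) < E(p + 1, q)`. Tasaki, J. Phys.: Condens. Matter 10 (1998) 4353, §5, inequality
after Theorem 5.2 (`E_min(S) < E_min(S+1)`, `S₀ ≤ S ≤ |Λ|/2 - 1`). [cite: Tasaki1998, §5] -/
theorem hubbard_halfFilled_minEnergyOn_upDownSector_lt (hG : G.Connected) (A : Finset Λ)
    (hA : ∀ x y : Λ, G.Adj x y → (x ∈ A ↔ y ∉ A)) {t U : ℝ} (ht : t ≠ 0) (hU : 0 < U)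
    {p q : ℕ} (hpq : p + (q + 1) = Fintype.card Λ) (hqA : q + 1 ≤ A.card) (hqB : q + 1 ≤ Aᶜ.card) :
    (hamiltonian G t U).minEnergyOn (szSector (p + (q + 1)) (((p : ℝ) - (q + 1 : ℕ)) / 2)) <
      (hamiltonian G t U).minEnergyOn (szSector (p + 1 + q) ((((p + 1 : ℕ) : ℝ) - q) / 2)) := by
  classical
  set H := hamiltonian G t U with hHdef
  set E := H.minEnergyOn (szSector (p + (q + 1)) (((p : ℝ) - (q + 1 : ℕ)) / 2)) with hEdef
  set E' := H.minEnergyOn (szSector (p + 1 + q) ((((p + 1 : ℕ) : ℝ) - q) / 2)) with hE'def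
  have hAB := Finset.card_add_card_compl A
  -- upper sector ground state and lower sector form bound
  obtain ⟨⟨ψ₁, hψ₁, hψ₁0, hHψ₁⟩, -⟩ :=
    upDownSector_groundState G t U (a := p + 1) (b := q) (by omega) (by omega)
  obtain ⟨-, hbd⟩ := upDownSector_groundState G t U (a := p) (b := q + 1) (by omega) (by omega)
  set φ := Literature.MathematicalPhysics.QuantumLattice.spinMinus *ᵥ ψ₁ with hφdef
  have hφsec : IsInSector p (q + 1) φ := LiebThm1.lowersSpin_spinMinus.isInSector_mulVec hψ₁
  have hqp : q < p + 1 := by omega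
  have hφ0 : φ ≠ 0 := fun h0 => hψ₁0 (LiebThm1.eq_zero_of_spinMinus_mulVec_eq_zero hqp hψ₁ h0)
  have hHφ : H *ᵥ φ = (E' : ℂ) • φ := by
    rw [hφdef, mulVec_mulVec, hHdef, (LiebThm1.hamiltonian_commute_spinMinus G t U).eq,
      ← mulVec_mulVec, ← hHdef, hHψ₁, mulVec_smul]
  have hle : E ≤ E' := by
    have h1 := hbd φ hφsec
    rw [expect, hHφ, dotProduct_smul, smul_eq_mul, Complex.re_ofReal_mul] at h1
    exact le_of_mul_le_mul_right h1 ((Complex.pos_iff.1 (dotProduct_star_self_pos_iff.2 hφ0)).1)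
  refine lt_of_le_of_ne hle fun heq => ?_
  -- if `E = E'`, `φ = S⁻ψ₁` is a ground state of the lower sector, hence highest weight
  rw [← heq] at hHφ
  have hPφ : spinPlus *ᵥ φ = 0 :=
    LiebTwo.halfFilled_upDownSector_groundState_spinPlus_eq_zero G hG A hA ht hU hpq hqA hqB hφsec hHφ
  have hnorm : star φ ⬝ᵥ φ = 0 := by
    rw [hφdef, LiebTwo.isSu2Triple_spin.star_M_mulVec_dotProduct, ← hφdef, hPφ, dotProduct_zero]
  exact hφ0 (dotProduct_star_self_eq_zero.1 hnorm)

/-- **Lieb–Mattis ordering at half filling, `S^z` form.** Under Lieb's hypotheses, if the joint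
sector `(|Λ|, S^z = M)` is realised as `(N↑, N↓) = (p, q)` (`p + q = |Λ|`, `M = (p - q)/2`) with
`1 ≤ q ≤ |A|` and `q ≤ |Aᶜ|` — i.e. `S₀ ≤ M ≤ |Λ|/2 - 1` — then `E(|Λ|, M) < E(|Λ|, M + 1)`.
Tasaki (1998) §5, inequality after Theorem 5.2. [cite: Tasaki1998, §5] -/
theorem hubbard_halfFilled_minEnergyOn_szSector_lt_succ (hG : G.Connected) (A : Finset Λ)
    (hA : ∀ x y : Λ, G.Adj x y → (x ∈ A ↔ y ∉ A)) {t U : ℝ} (ht : t ≠ 0) (hU : 0 < U)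
    {M : ℝ} (p q : ℕ) (hpq : p + q = Fintype.card Λ) (hM : ((p : ℝ) - q) / 2 = M)
    (hq : 1 ≤ q) (hqA : q ≤ A.card) (hqB : q ≤ Aᶜ.card) :
    (hamiltonian G t U).minEnergyOn (szSector (Fintype.card Λ) M) <
      (hamiltonian G t U).minEnergyOn (szSector (Fintype.card Λ) (M + 1)) := by
  obtain ⟨q', rfl⟩ : ∃ q', q = q' + 1 := ⟨q - 1, by omega⟩
  have h := hubbard_halfFilled_minEnergyOn_upDownSector_lt G hG A hA ht hU (p := p) (q := q')
    hpq hqA hqB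
  have e1 : p + 1 + q' = Fintype.card Λ := by omega
  have e2 : (((p + 1 : ℕ) : ℝ) - q') / 2 = M + 1 := by rw [← hM]; push_cast; ring
  rwa [hpq, hM, e1, e2] at h

/-- **Uniqueness of the sector ground states at half filling** (every `S^z` sector, no condition
on `M`): under Lieb's hypotheses, for `p + q = |Λ|` there is a nonzero `ψ₀` in the coordinate
sector `(p, q)` with `H ψ₀ = E(p, q) ψ₀` such that every `ψ` in the sector with `H ψ = E(p, q) ψ`
is a multiple of `ψ₀`. Lieb, PRL 62 (1989) 1201, Theorem 1(b) via the proof of Theorem 2.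
[cite: LiebPRL1989, Theorems 1 and 2] -/
theorem hubbard_halfFilled_upDownSector_groundState_unique (hG : G.Connected) (A : Finset Λ)
    (hA : ∀ x y : Λ, G.Adj x y → (x ∈ A ↔ y ∉ A)) {t U : ℝ} (ht : t ≠ 0) (hU : 0 < U)
    {p q : ℕ} (hpq : p + q = Fintype.card Λ) :
    ∃ ψ₀ : Fock (Orb Λ), IsInSector p q ψ₀ ∧ ψ₀ ≠ 0 ∧
      hamiltonian G t U *ᵥ ψ₀ =
        (((hamiltonian G t U).minEnergyOn (szSector (p + q) (((p : ℝ) - q) / 2)) : ℝ) : ℂ) • ψ₀ ∧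
      ∀ ψ : Fock (Orb Λ), IsInSector p q ψ →
        hamiltonian G t U *ᵥ ψ =
          (((hamiltonian G t U).minEnergyOn (szSector (p + q) (((p : ℝ) - q) / 2)) : ℝ) : ℂ) • ψ →
        ∃ c : ℂ, ψ = c • ψ₀ := by
  obtain ⟨W₀, -, h0, hH, huniq⟩ := LiebTwo.halfFilled_upDownSector_groundState G hG A hA ht hU hpq
  exact ⟨_, LiebTwo.isInSector_toFockN A hpq W₀, h0, hH, huniq⟩

/-- **The spin of the sector ground states at half filling.** Under Lieb's hypotheses, for
`p + q = |Λ|`, `q ≤ |A|`, `q ≤ |Aᶜ|` (`M = (p - q)/2 ≥ S₀`): every `ψ` in the coordinate sector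
`(p, q)` with `H ψ = E(p, q) ψ` satisfies `S⁺ ψ = 0` and `S² ψ = M(M + 1) ψ` — the lowest state of
`S^z = M` has total spin exactly `M`. Tasaki (1998) §5 (after Thm 5.2). [cite: Tasaki1998, §5] -/
theorem hubbard_halfFilled_upDownSector_groundState_spin (hG : G.Connected) (A : Finset Λ)
    (hA : ∀ x y : Λ, G.Adj x y → (x ∈ A ↔ y ∉ A)) {t U : ℝ} (ht : t ≠ 0) (hU : 0 < U)
    {p q : ℕ} (hpq : p + q = Fintype.card Λ) (hqA : q ≤ A.card) (hqB : q ≤ Aᶜ.card)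
    {ψ : Fock (Orb Λ)} (hψ : IsInSector p q ψ)
    (hHψ : hamiltonian G t U *ᵥ ψ =
      (((hamiltonian G t U).minEnergyOn (szSector (p + q) (((p : ℝ) - q) / 2)) : ℝ) : ℂ) • ψ) :
    spinPlus *ᵥ ψ = 0 ∧
      spinSq *ᵥ ψ = (((((p : ℝ) - q) / 2) * (((p : ℝ) - q) / 2 + 1) : ℝ) : ℂ) • ψ :=
  ⟨LiebTwo.halfFilled_upDownSector_groundState_spinPlus_eq_zero G hG A hA ht hU hpq hqA hqB hψ hHψ,
    LiebTwo.halfFilled_upDownSector_groundState_spinSq G hG A hA ht hU hpq hqA hqB hψ hHψ⟩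

/-! ### The balanced case `|A| = |B|` -/

/-- **Balanced bipartite graphs (`|Aᶜ| = |A| = n`, `|Λ| = 2n`): the sector energies of the
half-filled Hubbard model are STRICTLY increasing in `S^z` on `0 ≤ S^z ≤ n`**:
`E(2n, m) < E(2n, m + 1)` for every natural `m` with `m + 1 ≤ n` (`G` connected, `t ≠ 0`, `U > 0`).
With `E₀(2n) = E(2n, 0)` (`groundEnergyAt_eq_minEnergyOn_szSector`) and evenness in `S^z`
(`hubbard_minEnergyOn_szSector_neg`): `E₀ = E(0) < E(±1) < E(±2) < ⋯ < E(±n)`.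
Tasaki (1998) §5, inequality after Theorem 5.2 (`S₀ = 0`). [cite: Tasaki1998, §5] -/
theorem hubbard_halfFilled_balanced_minEnergyOn_szSector_lt_succ (hG : G.Connected) (A : Finset Λ)
    (hA : ∀ x y : Λ, G.Adj x y → (x ∈ A ↔ y ∉ A)) (hcard : Aᶜ.card = A.card)
    {t U : ℝ} (ht : t ≠ 0) (hU : 0 < U) {m : ℕ} (hm : m + 1 ≤ A.card) :
    (hamiltonian G t U).minEnergyOn (szSector (Fintype.card Λ) (m : ℝ)) <
      (hamiltonian G t U).minEnergyOn (szSector (Fintype.card Λ) ((m : ℝ) + 1)) := by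
  have hAB := Finset.card_add_card_compl A
  exact hubbard_halfFilled_minEnergyOn_szSector_lt_succ G hG A hA ht hU (A.card + m) (A.card - m)
    (by omega) (by rw [Nat.cast_sub (by omega)]; push_cast; ring) (by omega) (by omega) (by omega)

/-- **Balanced case: the lowest `S^z = 1` state at half filling is a TRIPLET.** For `|Aᶜ| = |A| = n ≥ 1`
every `ψ` in the coordinate sector `(n + 1, n - 1)` (`= szSector (2n) 1`) with `H ψ = E(2n, 1) ψ`
has `S⁺ψ = 0` and `S² ψ = 2 ψ`; so `E(2n, 1) - E₀(2n)` is the singlet–triplet gap.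
Tasaki (1998) §5 (after Thm 5.2). [cite: Tasaki1998, §5] -/
theorem hubbard_halfFilled_balanced_szSector_one_groundState_spinSq (hG : G.Connected) (A : Finset Λ)
    (hA : ∀ x y : Λ, G.Adj x y → (x ∈ A ↔ y ∉ A)) (hcard : Aᶜ.card = A.card) (hA1 : 1 ≤ A.card)
    {t U : ℝ} (ht : t ≠ 0) (hU : 0 < U) {ψ : Fock (Orb Λ)}
    (hψ : IsInSector (A.card + 1) (A.card - 1) ψ)
    (hHψ : hamiltonian G t U *ᵥ ψ =
      (((hamiltonian G t U).minEnergyOn (szSector (Fintype.card Λ) 1) : ℝ) : ℂ) • ψ) :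
    spinPlus *ᵥ ψ = 0 ∧ spinSq *ᵥ ψ = (2 : ℂ) • ψ := by
  have hAB := Finset.card_add_card_compl A
  have hpq : A.card + 1 + (A.card - 1) = Fintype.card Λ := by omega
  have hM : (((A.card + 1 : ℕ) : ℝ) - (A.card - 1 : ℕ)) / 2 = 1 := by
    rw [Nat.cast_sub hA1]; push_cast; ring
  have hHψ' : hamiltonian G t U *ᵥ ψ =
      (((hamiltonian G t U).minEnergyOn (szSector (A.card + 1 + (A.card - 1))
        ((((A.card + 1 : ℕ) : ℝ) - (A.card - 1 : ℕ)) / 2)) : ℝ) : ℂ) • ψ := by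
    rw [hpq, hM]; exact hHψ
  obtain ⟨hP, hS⟩ := hubbard_halfFilled_upDownSector_groundState_spin G hG A hA ht hU hpq
    (by omega) (by omega) hψ hHψ'
  refine ⟨hP, ?_⟩
  rw [hS, hM]
  norm_num

end Ordering

/-! ### The even square torus -/

section Torus

open Literature.Probability.LatticeModels

variable {L : ℕ} [NeZero L]

omit [NeZero L] in
/-- `|(ℤ/Lℤ)²| = L²`. [folklore] -/
private theorem card_fermionTorus_two'' : Fintype.card (FermionTorus 2 L) = L ^ 2 := by
  simp only [FermionTorus, Fintype.card_lex, Fintype.card_fun, Fintype.card_fin]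

/-- **Lieb–Mattis ordering on the even square torus at half filling**: for even `L ≠ 0`, `t ≠ 0`,
`U > 0` and every natural `m` with `2(m + 1) ≤ L²`:
`E(L², S^z = m) < E(L², S^z = m + 1)` for `hamiltonian (fermionTorusGraph 2 L) t U`
(so `E₀(L²) = E(L², 0) < E(L², 1) < E(L², 2) < ⋯`). Tasaki (1998) §5, inequality after
Theorem 5.2, with Lieb's hypotheses supplied by `hubbardTorus_lieb_hypotheses`.
[cite: Tasaki1998, §5] -/
theorem hubbardTorus_minEnergyOn_szSector_lt_succ (hL : Even L) {t U : ℝ} (ht : t ≠ 0)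
    (hU : 0 < U) {m : ℕ} (hm : 2 * (m + 1) ≤ L ^ 2) :
    (hamiltonian (fermionTorusGraph 2 L) t U).minEnergyOn (szSector (L ^ 2) (m : ℝ)) <
      (hamiltonian (fermionTorusGraph 2 L) t U).minEnergyOn (szSector (L ^ 2) ((m : ℝ) + 1)) := by
  obtain ⟨hG, hA, h2, -⟩ := LiebHalfFilled.hubbardTorus_lieb_hypotheses (L := L) hL
  have hcard := LiebHalfFilled.compl_card_eq_card_of_two_mul h2
  rw [card_fermionTorus_two''] at h2
  have h := hubbard_halfFilled_balanced_minEnergyOn_szSector_lt_succ (fermionTorusGraph 2 L) hG _ hA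
    hcard ht hU (m := m) (by omega)
  rw [card_fermionTorus_two''] at h
  convert h using 2

/-- **The lowest `S^z = 1` state of the half-filled even square torus is a triplet**: for even
`L ≠ 0`, `t ≠ 0`, `U > 0`, every `ψ` in the coordinate sector `(N↑, N↓) = (L²/2 + 1, L²/2 - 1)`
with `H ψ = E(L², 1) ψ` has `S⁺ ψ = 0` and `S² ψ = 2 ψ`; hence the cell's certified
`E(L², 1) - E₀(L²)` is the singlet–triplet gap `E(S = 1) - E(S = 0)`.
Tasaki (1998) §5 (after Thm 5.2). [cite: Tasaki1998, §5] -/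
theorem hubbardTorus_szSector_one_groundState_spinSq (hL : Even L) {t U : ℝ} (ht : t ≠ 0)
    (hU : 0 < U) {ψ : Fock (Orb (FermionTorus 2 L))}
    (hψ : IsInSector (L ^ 2 / 2 + 1) (L ^ 2 / 2 - 1) ψ)
    (hHψ : hamiltonian (fermionTorusGraph 2 L) t U *ᵥ ψ =
      (((hamiltonian (fermionTorusGraph 2 L) t U).minEnergyOn (szSector (L ^ 2) 1) : ℝ) : ℂ) • ψ) :
    spinPlus *ᵥ ψ = 0 ∧ spinSq *ᵥ ψ = (2 : ℂ) • ψ := by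
  obtain ⟨hG, hA, h2, hne⟩ := LiebHalfFilled.hubbardTorus_lieb_hypotheses (L := L) hL
  have hcard := LiebHalfFilled.compl_card_eq_card_of_two_mul h2
  rw [card_fermionTorus_two''] at h2
  set A := (univ.filter fun x : FermionTorus 2 L => torusStagger x = 1) with hAdef
  have hAc : A.card = L ^ 2 / 2 := by omega
  have hA1 : 1 ≤ A.card := hne.card_pos
  have h := hubbard_halfFilled_balanced_szSector_one_groundState_spinSq (fermionTorusGraph 2 L) hG A hA
    hcard hA1 ht hU (ψ := ψ) (by rw [hAc]; convert hψ using 1)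
  rw [card_fermionTorus_two''] at h
  exact h (by convert hHψ using 2)

end Torus

end Literature.MathematicalPhysics.QuantumLattice

/-! ### Tasaki's `E_min(S)`: raising a spin-`S` vector to `S^z = S` -/

namespace Literature.MathematicalPhysics.QuantumLattice

open Matrix Finset
open scoped ComplexOrder

section SpinRaising

variable {Λ : Type*} [LinearOrder Λ] [Fintype Λ]

/-- A product (spin-raising matrix) · (spin-lowering matrix) conserves `(N↑, N↓)`. [folklore] -/
private theorem preservesSectors_mul_of_raises_lowers {P M : Matrix (Finset (Orb Λ)) (Finset (Orb Λ)) ℂ}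
    (hP : RaisesSpin P) (hM : LowersSpin M) : PreservesSectors (P * M) := by
  intro s s' h
  rw [Matrix.mul_apply] at h
  obtain ⟨u, -, hu⟩ := Finset.exists_ne_zero_of_sum_ne_zero h
  have h1 := hP s u (left_ne_zero_of_mul hu)
  have h2 := hM u s' (right_ne_zero_of_mul hu)
  omega

/-- A product (spin-lowering matrix) · (spin-raising matrix) conserves `(N↑, N↓)`. [folklore] -/
private theorem preservesSectors_mul_of_lowers_raises {P M : Matrix (Finset (Orb Λ)) (Finset (Orb Λ)) ℂ}
    (hM : LowersSpin M) (hP : RaisesSpin P) : PreservesSectors (M * P) := by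
  intro s s' h
  rw [Matrix.mul_apply] at h
  obtain ⟨u, -, hu⟩ := Finset.exists_ne_zero_of_sum_ne_zero h
  have h1 := hM s u (left_ne_zero_of_mul hu)
  have h2 := hP u s' (right_ne_zero_of_mul hu)
  omega

-- (A public copy of the next statement exists Summits-side,
-- `Summit.HubbardSuperconductivity.NoGo.preservesSectors_spinSq`; Literature cannot import Summits,
-- so it is re-proved here as a private helper.)
/-- **`S²` conserves `(N↑, N↓)`** (`S² = (S^z)² + ½(S⁺S⁻ + S⁻S⁺)`; `S^z` is diagonal and the two
products move one electron back and forth between the spin species). Lieb, PRL 62 (1989) 1201,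
eq. (2). [cite: LiebPRL1989, eq. (2)] -/
private theorem preservesSectors_spinSq : PreservesSectors (spinSq : Matrix (Finset (Orb Λ)) (Finset (Orb Λ)) ℂ) := by
  unfold spinSq
  refine PreservesSectors.add ?_ (PreservesSectors.smul (PreservesSectors.add ?_ ?_) _)
  · rw [LiebThm1.spinZ_eq_diagonal]
    exact (PreservesSectors.diagonal _).mul (PreservesSectors.diagonal _)
  · exact preservesSectors_mul_of_raises_lowers LiebThm1.raisesSpin_spinPlus LiebThm1.lowersSpin_spinMinus
  · exact preservesSectors_mul_of_lowers_raises LiebThm1.lowersSpin_spinMinus LiebThm1.raisesSpin_spinPlus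

/-- The identity behind the Hermitian form of a sector-preserving matrix: cross terms between
different sectors vanish, `⟨φ, X φ⟩ = Σ_a ⟨φ_a, X φ_a⟩` over the sector components
`φ_a = sectorProj a (N - a) φ` of an `N`-particle vector. [folklore] -/
private theorem star_dotProduct_mulVec_eq_sum_sectorProj {X : Matrix (Finset (Orb Λ)) (Finset (Orb Λ)) ℂ}
    (hX : PreservesSectors X) {N : ℕ} {φ : Fock (Orb Λ)} (hφ : IsNParticle N φ) :
    star φ ⬝ᵥ (X *ᵥ φ) =
      ∑ a ∈ range (N + 1), star (sectorProj a (N - a) φ) ⬝ᵥ (X *ᵥ sectorProj a (N - a) φ) := by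
  classical
  conv_lhs => rw [← sum_sectorProj_eq hφ]
  rw [star_sum, sum_dotProduct, mulVec_sum]
  refine Finset.sum_congr rfl fun a ha => ?_
  rw [dotProduct_sum]
  refine Finset.sum_eq_single a (fun a' ha' hne => ?_) (fun h => absurd ha h)
  exact dotProduct_eq_zero_of_isInSector (a := a) (b := N - a) (a' := a') (b' := N - a')
    (fun h => hne h.1.symm) (isInSector_sectorProj _ _ _)
    (hX.isInSector_mulVec (isInSector_sectorProj _ _ _))

/-- The identity matrix conserves sectors. [folklore] -/
private theorem preservesSectors_one : PreservesSectors (1 : Matrix (Finset (Orb Λ)) (Finset (Orb Λ)) ℂ) := by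
  rw [← Matrix.diagonal_one]
  exact PreservesSectors.diagonal _

/-- **One raising step preserves the Rayleigh quotient.** For `H` commuting with `S⁻`, a vector `w`
of the sector `(a, b + 1)` with `S² w = ℓ w` is sent by `S⁺` to a vector of the sector `(a + 1, b)`
with `S²(S⁺w) = ℓ S⁺w`, `‖S⁺w‖² = κ ‖w‖²` and `⟨S⁺w, H S⁺w⟩ = κ ⟨w, H w⟩`,
`κ = ℓ - m(m + 1)`, `m = (a - b - 1)/2` (`S⁻S⁺ = S² - (S^z)² - S^z`). Tasaki (1998) §2 / (2020)
§2.4; Lieb, PRL 62 (1989) 1201, eq. (2). [cite: LiebPRL1989, eq. (2)] -/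
theorem spinPlus_raise_step {H : Matrix (Finset (Orb Λ)) (Finset (Orb Λ)) ℂ}
    (hcommM : Commute H Literature.MathematicalPhysics.QuantumLattice.spinMinus)
    {a b : ℕ} {w : Fock (Orb Λ)} (hw : IsInSector a (b + 1) w) {l : ℂ} (hC : spinSq *ᵥ w = l • w) :
    IsInSector (a + 1) b (spinPlus *ᵥ w) ∧
      spinSq *ᵥ (spinPlus *ᵥ w) = l • (spinPlus *ᵥ w) ∧
      star (spinPlus *ᵥ w) ⬝ᵥ (spinPlus *ᵥ w) =
        (l - ((1 / 2 : ℂ) * ((a : ℂ) - (b + 1 : ℕ))) * ((1 / 2 : ℂ) * ((a : ℂ) - (b + 1 : ℕ))) -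
          (1 / 2 : ℂ) * ((a : ℂ) - (b + 1 : ℕ))) * (star w ⬝ᵥ w) ∧
      star (spinPlus *ᵥ w) ⬝ᵥ (H *ᵥ (spinPlus *ᵥ w)) =
        (l - ((1 / 2 : ℂ) * ((a : ℂ) - (b + 1 : ℕ))) * ((1 / 2 : ℂ) * ((a : ℂ) - (b + 1 : ℕ))) -
          (1 / 2 : ℂ) * ((a : ℂ) - (b + 1 : ℕ))) * (star w ⬝ᵥ (H *ᵥ w)) := by
  have T := LiebTwo.isSu2Triple_spin (Λ := Λ)
  set cz : ℂ := (1 / 2 : ℂ) * ((a : ℂ) - (b + 1 : ℕ)) with hcz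
  have hZ : HubbardWave0.spinZ *ᵥ w = cz • w := by
    rw [LiebThm1.spinZ_mulVec_of_isInSector hw]
  -- `S⁻ S⁺ w = (ℓ - cz² - cz) w`
  have hMP : Literature.MathematicalPhysics.QuantumLattice.spinMinus *ᵥ (spinPlus *ᵥ w) =
      (l - cz * cz - cz) • w := by
    have hmp : (Literature.MathematicalPhysics.QuantumLattice.spinMinus * spinPlus :
        Matrix (Finset (Orb Λ)) (Finset (Orb Λ)) ℂ) =
        spinSq - HubbardWave0.spinZ * HubbardWave0.spinZ - HubbardWave0.spinZ := by
      rw [← LiebTwo.su2Casimir_spin_eq_spinSq, T.su2Casimir_eq]; abel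
    rw [mulVec_mulVec, hmp, sub_mulVec, sub_mulVec, ← mulVec_mulVec, hZ, mulVec_smul, hZ, hC,
      smul_smul, ← sub_smul, ← sub_smul]
  refine ⟨LiebThm1.raisesSpin_spinPlus.isInSector_mulVec hw, ?_, ?_, ?_⟩
  · rw [mulVec_mulVec, ← LiebTwo.su2Casimir_spin_eq_spinSq, T.su2Casimir_mul_P, ← mulVec_mulVec,
      LiebTwo.su2Casimir_spin_eq_spinSq, hC, mulVec_smul]
  · rw [T.star_P_mulVec_dotProduct, hMP, dotProduct_smul, smul_eq_mul]
  · rw [T.star_P_mulVec_dotProduct, mulVec_mulVec, ← hcommM.eq, ← mulVec_mulVec, hMP, mulVec_smul,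
      dotProduct_smul, smul_eq_mul]

/-- **A vector of spin `S` in a sector of weight `m > S` or `m < -S` vanishes** (`‖S⁺w‖² =
(S - m)(S + m + 1)‖w‖²`, `‖S⁻w‖² = (S + m)(S - m + 1)‖w‖²` must be nonnegative). Here the weight
of the sector `(a, b)` is `m = (a - b)/2` and `S = (p - q)/2` with `a + b = p + q`, `q ≤ p`.
Tasaki (2020) §2.4 / App. A.3. [cite: Tasaki1998, §2] -/
theorem eq_zero_of_spinSq_of_weight_out_of_range {a b p q : ℕ} (hab : a + b = p + q) (hqp : q ≤ p)
    {w : Fock (Orb Λ)} (hw : IsInSector a b w)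
    (hC : spinSq *ᵥ w = (((((p : ℝ) - q) / 2) * (((p : ℝ) - q) / 2 + 1) : ℝ) : ℂ) • w)
    (hout : p < a ∨ a + p < p + q) : w = 0 := by
  have T := LiebTwo.isSu2Triple_spin (Λ := Λ)
  set S : ℝ := ((p : ℝ) - q) / 2 with hS
  set m : ℝ := ((a : ℝ) - b) / 2 with hm
  have hZ : HubbardWave0.spinZ *ᵥ w = ((m : ℝ) : ℂ) • w := by
    rw [LiebThm1.spinZ_mulVec_of_isInSector hw, hm]; congr 1; push_cast; ring
  have hCas : Literature.MathematicalPhysics.QuantumLattice.su2Casimir spinPlus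
      Literature.MathematicalPhysics.QuantumLattice.spinMinus HubbardWave0.spinZ *ᵥ w =
      (((S * (S + 1) : ℝ)) : ℂ) • w := by rw [LiebTwo.su2Casimir_spin_eq_spinSq, hC]
  by_contra hw0
  obtain ⟨hqre, -⟩ := Complex.pos_iff.1 (dotProduct_star_self_pos_iff.2 hw0)
  rcases hout with hgt | hlt
  · -- `m > S`: `‖S⁺ w‖² = (S - m)(S + m + 1) ‖w‖² < 0`
    have hnorm : star (spinPlus *ᵥ w) ⬝ᵥ (spinPlus *ᵥ w) =
        (((S - m) * (S + m + 1) : ℝ) : ℂ) * (star w ⬝ᵥ w) := by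
      have hmp : (Literature.MathematicalPhysics.QuantumLattice.spinMinus * spinPlus :
          Matrix (Finset (Orb Λ)) (Finset (Orb Λ)) ℂ) =
          Literature.MathematicalPhysics.QuantumLattice.su2Casimir spinPlus
            Literature.MathematicalPhysics.QuantumLattice.spinMinus HubbardWave0.spinZ -
            HubbardWave0.spinZ * HubbardWave0.spinZ - HubbardWave0.spinZ := by
        rw [T.su2Casimir_eq]; abel
      rw [T.star_P_mulVec_dotProduct, mulVec_mulVec, hmp, sub_mulVec, sub_mulVec, ← mulVec_mulVec, hZ,
        mulVec_smul, hZ, hCas, smul_smul, ← sub_smul, ← sub_smul, dotProduct_smul, smul_eq_mul]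
      congr 1; push_cast; ring
    have hr : (S - m) * (S + m + 1) < 0 := by
      have h1 : S - m < 0 := by
        rw [hS, hm]
        have : (p : ℝ) < a := by exact_mod_cast hgt
        have hb : (b : ℝ) = (p : ℝ) + q - a := by
          have := congrArg (fun n : ℕ => (n : ℝ)) hab; push_cast at this; linarith
        rw [hb]; linarith
      have h2 : 0 < S + m + 1 := by
        rw [hS, hm]
        have hb : (b : ℝ) = (p : ℝ) + q - a := by
          have := congrArg (fun n : ℕ => (n : ℝ)) hab; push_cast at this; linarith
        have : (q : ℝ) ≤ p := by exact_mod_cast hqp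
        have : (p : ℝ) < a := by exact_mod_cast hgt
        rw [hb]; linarith
      exact mul_neg_of_neg_of_pos h1 h2
    obtain ⟨hpre, -⟩ := Complex.nonneg_iff.1 (dotProduct_star_self_nonneg (spinPlus *ᵥ w))
    rw [hnorm, Complex.mul_re, Complex.ofReal_re, Complex.ofReal_im, zero_mul, sub_zero] at hpre
    have := mul_neg_of_neg_of_pos hr hqre
    linarith
  · -- `m < -S`: `‖S⁻ w‖² = (S + m)(S - m + 1) ‖w‖² < 0`
    have hnorm : star (Literature.MathematicalPhysics.QuantumLattice.spinMinus *ᵥ w) ⬝ᵥ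
        (Literature.MathematicalPhysics.QuantumLattice.spinMinus *ᵥ w) =
        (((S + m) * (S - m + 1) : ℝ) : ℂ) * (star w ⬝ᵥ w) := by
      have hpm : (spinPlus * Literature.MathematicalPhysics.QuantumLattice.spinMinus :
          Matrix (Finset (Orb Λ)) (Finset (Orb Λ)) ℂ) =
          Literature.MathematicalPhysics.QuantumLattice.su2Casimir spinPlus
            Literature.MathematicalPhysics.QuantumLattice.spinMinus HubbardWave0.spinZ -
            HubbardWave0.spinZ * HubbardWave0.spinZ + HubbardWave0.spinZ := by
        rw [T.su2Casimir_eq']; abel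
      rw [T.star_M_mulVec_dotProduct, mulVec_mulVec, hpm, add_mulVec, sub_mulVec, ← mulVec_mulVec, hZ,
        mulVec_smul, hZ, hCas, smul_smul, ← sub_smul, ← add_smul, dotProduct_smul, smul_eq_mul]
      congr 1; push_cast; ring
    have hr : (S + m) * (S - m + 1) < 0 := by
      have hb : (b : ℝ) = (p : ℝ) + q - a := by
        have := congrArg (fun n : ℕ => (n : ℝ)) hab; push_cast at this; linarith
      have hlt' : (a : ℝ) + p < p + q := by exact_mod_cast hlt
      have h1 : S + m < 0 := by rw [hS, hm, hb]; linarith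
      have h2 : 0 < S - m + 1 := by
        have : (q : ℝ) ≤ p := by exact_mod_cast hqp
        rw [hS, hm, hb]; linarith
      exact mul_neg_of_neg_of_pos h1 h2
    obtain ⟨hpre, -⟩ := Complex.nonneg_iff.1
      (dotProduct_star_self_nonneg (Literature.MathematicalPhysics.QuantumLattice.spinMinus *ᵥ w))
    rw [hnorm, Complex.mul_re, Complex.ofReal_re, Complex.ofReal_im, zero_mul, sub_zero] at hpre
    have := mul_neg_of_neg_of_pos hr hqre
    linarith

/-- **Raising a spin-`S` component to `S^z = S` transports a sector form bound down.** If `H`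
(commuting with `S⁻`) satisfies `E ‖φ‖² ≤ Re ⟨φ, H φ⟩` on the sector `(p, q)` (`q ≤ p`,
`S = (p - q)/2`), then the same bound holds for every `w` of a sector `(a, b)`, `a + b = p + q`,
`a ≤ p`, `p + q ≤ a + p` (weight `-S ≤ m ≤ S`) with `S² w = S(S+1) w`: apply `S⁺` `p - a` times, each
step multiplying `‖·‖²` and `⟨·, H ·⟩` by the same positive factor `(S - m)(S + m + 1)`.
Tasaki (1998) §2 (Definition 2.1 and the `SU(2)` remarks); Lieb, PRL 62 (1989) 1201, proof of
Theorem 1. [cite: Tasaki1998, §2] -/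
theorem sector_form_bound_of_spinSq {H : Matrix (Finset (Orb Λ)) (Finset (Orb Λ)) ℂ}
    (hcommM : Commute H Literature.MathematicalPhysics.QuantumLattice.spinMinus)
    {p q : ℕ} (hqp : q ≤ p) {E : ℝ}
    (hbd : ∀ φ : Fock (Orb Λ), IsInSector p q φ → E * (star φ ⬝ᵥ φ).re ≤ (star φ ⬝ᵥ H *ᵥ φ).re) :
    ∀ (j a b : ℕ) (w : Fock (Orb Λ)), a + j = p → b = q + j → p + q ≤ a + p → IsInSector a b w →
      spinSq *ᵥ w = (((((p : ℝ) - q) / 2) * (((p : ℝ) - q) / 2 + 1) : ℝ) : ℂ) • w →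
      E * (star w ⬝ᵥ w).re ≤ (star w ⬝ᵥ H *ᵥ w).re := by
  intro j
  induction j with
  | zero =>
    intro a b w ha hb _ hw _
    rw [add_zero] at ha
    rw [add_zero] at hb
    subst ha; subst hb
    exact hbd w hw
  | succ j ih =>
    intro a b w ha hb hlow hw hC
    obtain ⟨b', rfl⟩ : ∃ b', b = b' + 1 := ⟨b - 1, by omega⟩
    obtain ⟨hw', hC', hnorm, hform⟩ := spinPlus_raise_step hcommM hw hC
    -- the factor `κ = S(S+1) - m(m+1) = (S - m)(S + m + 1)` is a positive real
    set S : ℝ := ((p : ℝ) - q) / 2 with hS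
    set m : ℝ := ((a : ℝ) - (b' + 1 : ℕ)) / 2 with hm
    have hκ : ((((S * (S + 1) : ℝ)) : ℂ) - ((1 / 2 : ℂ) * ((a : ℂ) - (b' + 1 : ℕ))) *
        ((1 / 2 : ℂ) * ((a : ℂ) - (b' + 1 : ℕ))) - (1 / 2 : ℂ) * ((a : ℂ) - (b' + 1 : ℕ))) =
        ((((S - m) * (S + m + 1) : ℝ)) : ℂ) := by
      rw [hm]; push_cast; ring
    have hκpos : 0 < (S - m) * (S + m + 1) := by
      have hb' : ((b' + 1 : ℕ) : ℝ) = (q : ℝ) + j + 1 := by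
        have := congrArg (fun n : ℕ => (n : ℝ)) hb; push_cast at this ⊢; linarith
      have ha' : (a : ℝ) + j + 1 = p := by
        have := congrArg (fun n : ℕ => (n : ℝ)) ha; push_cast at this; linarith
      have hlow' : (p : ℝ) + q ≤ a + p := by exact_mod_cast hlow
      refine mul_pos ?_ ?_
      · rw [hS, hm, hb']; linarith
      · rw [hS, hm, hb']; linarith
    rw [hκ] at hnorm hform
    have ih' := ih (a + 1) b' (spinPlus *ᵥ w) (by omega) (by omega) (by omega) hw' hC'
    rw [hnorm, hform, Complex.re_ofReal_mul, Complex.re_ofReal_mul, ← mul_assoc, mul_comm E,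
      mul_assoc] at ih'
    exact le_of_mul_le_mul_left ih' hκpos

/-- **`E_min(S) ≥ E(N, S^z = S)` for any `SU(2)`-invariant fermion Hamiltonian.** Let `H` be
Hermitian, conserve `(N↑, N↓)` and commute with `S⁻`, and let the sector `(N↑, N↓) = (p, q)`,
`q ≤ p ≤ |Λ|`, carry the weight `S = (p - q)/2`. Then every `N = p + q`-particle vector `φ` with
`S² φ = S(S+1) φ` satisfies `E(p, q) ‖φ‖² ≤ Re ⟨φ, H φ⟩`, `E(p, q) = H.minEnergyOn (szSector (p+q)
((p-q)/2))` — a spin-`S` state, whatever its `S^z`-components, lies energetically above the lowest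
state of `S^z = S` (each component raises to `S^z = S` with its Rayleigh quotient unchanged).
This is the inequality `E_min(S) ≥ E(N, S^z = S)` implicit in Tasaki's Definition 2.1 /
Lieb–Mattis' use of `E(M)`. [cite: Tasaki1998, §2] -/
theorem minEnergyOn_szSector_mul_le_re_expect_of_spinSq {H : Matrix (Finset (Orb Λ)) (Finset (Orb Λ)) ℂ}
    (hH : H.IsHermitian) (hHs : PreservesSectors H)
    (hcommM : Commute H Literature.MathematicalPhysics.QuantumLattice.spinMinus)
    {p q : ℕ} (hqp : q ≤ p) (hp : p ≤ Fintype.card Λ) {φ : Fock (Orb Λ)} (hφN : IsNParticle (p + q) φ)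
    (hφC : spinSq *ᵥ φ = (((((p : ℝ) - q) / 2) * (((p : ℝ) - q) / 2 + 1) : ℝ) : ℂ) • φ) :
    H.minEnergyOn (szSector (p + q) (((p : ℝ) - q) / 2)) * (star φ ⬝ᵥ φ).re ≤
      (star φ ⬝ᵥ H *ᵥ φ).re := by
  classical
  set N := p + q with hNdef
  set E := H.minEnergyOn (szSector (p + q) (((p : ℝ) - q) / 2)) with hEdef
  obtain ⟨-, hbd⟩ := upDownSector_groundState_of_preservesSectors hH hHs (a := p) (b := q) hp (by omega)
  have hbd' : ∀ φ : Fock (Orb Λ), IsInSector p q φ → E * (star φ ⬝ᵥ φ).re ≤ (star φ ⬝ᵥ H *ᵥ φ).re :=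
    fun φ hφ => hbd φ hφ
  -- each sector component obeys the bound
  have hcomp : ∀ a ∈ range (N + 1),
      E * (star (sectorProj a (N - a) φ) ⬝ᵥ sectorProj a (N - a) φ).re ≤
        (star (sectorProj a (N - a) φ) ⬝ᵥ H *ᵥ sectorProj a (N - a) φ).re := by
    intro a ha
    rw [mem_range] at ha
    set w := sectorProj a (N - a) φ with hw
    have hwsec : IsInSector a (N - a) w := isInSector_sectorProj _ _ _
    have hwC : spinSq *ᵥ w = (((((p : ℝ) - q) / 2) * (((p : ℝ) - q) / 2 + 1) : ℝ) : ℂ) • w := by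
      rw [hw, preservesSectors_spinSq.mulVec_sectorProj, hφC, sectorProj_smul]
    by_cases hrange : a ≤ p ∧ p + q ≤ a + p
    · exact sector_form_bound_of_spinSq hcommM hqp hbd' (p - a) a (N - a) w (by omega) (by omega)
        hrange.2 hwsec hwC
    · have hw0 : w = 0 :=
        eq_zero_of_spinSq_of_weight_out_of_range (by omega) hqp hwsec hwC (by omega)
      rw [hw0, mulVec_zero, dotProduct_zero, Complex.zero_re, mul_zero]
  -- sum over the components
  have h1 : star φ ⬝ᵥ (H *ᵥ φ) = ∑ a ∈ range (N + 1),
      star (sectorProj a (N - a) φ) ⬝ᵥ (H *ᵥ sectorProj a (N - a) φ) :=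
    star_dotProduct_mulVec_eq_sum_sectorProj hHs hφN
  have h2 : star φ ⬝ᵥ φ = ∑ a ∈ range (N + 1),
      star (sectorProj a (N - a) φ) ⬝ᵥ sectorProj a (N - a) φ := by
    have h := star_dotProduct_mulVec_eq_sum_sectorProj preservesSectors_one hφN
    simpa only [one_mulVec] using h
  rw [h1, h2, Complex.re_sum, Complex.re_sum, Finset.mul_sum]
  exact Finset.sum_le_sum hcomp

end SpinRaising

/-! ### Tasaki's statement `E_min(S) < E_min(S + 1)` -/

section EminOrdering

variable {Λ : Type*} [LinearOrder Λ] [Fintype Λ] (G : SimpleGraph Λ) [DecidableRel G.Adj]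

/-- **`E_min(S) = E(|Λ|, S^z = S)` at half filling for `S ≥ S₀`.** Under Lieb's hypotheses, with
`E_min(S) := H.minEnergyOn (nParticleSubmodule |Λ| ⊓ eigenspace S² (S(S+1)))` — Tasaki's lowest
energy among `|Λ|`-electron states of total spin `S` (Definition 2.1) — and the sector
`(p, q)`, `p + q = |Λ|`, `q ≤ |A|, |Aᶜ|`, `S = (p - q)/2`: `E_min(S) = E(p, q)`. (`≥`: the raising
argument `minEnergyOn_szSector_mul_le_re_expect_of_spinSq`; `≤`: the sector ground state has
`S² = S(S+1)`, `hubbard_halfFilled_upDownSector_groundState_spin`.) [cite: Tasaki1998, §2 and §5] -/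
theorem hubbard_halfFilled_minEnergyOn_spinSq_eq (hG : G.Connected) (A : Finset Λ)
    (hA : ∀ x y : Λ, G.Adj x y → (x ∈ A ↔ y ∉ A)) {t U : ℝ} (ht : t ≠ 0) (hU : 0 < U)
    {p q : ℕ} (hpq : p + q = Fintype.card Λ) (hqA : q ≤ A.card) (hqB : q ≤ Aᶜ.card) :
    (hamiltonian G t U).minEnergyOn
        (nParticleSubmodule (ι := Orb Λ) (p + q) ⊓
          Module.End.eigenspace (Matrix.toLin' (spinSq : Matrix (Finset (Orb Λ)) _ ℂ))
            (((((p : ℝ) - q) / 2) * (((p : ℝ) - q) / 2 + 1) : ℝ) : ℂ)) =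
      (hamiltonian G t U).minEnergyOn (szSector (p + q) (((p : ℝ) - q) / 2)) := by
  classical
  set H := hamiltonian G t U with hHdef
  set l : ℂ := (((((p : ℝ) - q) / 2) * (((p : ℝ) - q) / 2 + 1) : ℝ) : ℂ) with hl
  set K : Submodule ℂ (Fock (Orb Λ)) := nParticleSubmodule (ι := Orb Λ) (p + q) ⊓
    Module.End.eigenspace (Matrix.toLin' (spinSq : Matrix (Finset (Orb Λ)) _ ℂ)) l with hK
  set E := H.minEnergyOn (szSector (p + q) (((p : ℝ) - q) / 2)) with hEdef
  have hAB := Finset.card_add_card_compl A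
  have hqp : q ≤ p := by omega
  have hHerm : H.IsHermitian := LiebThm1.hamiltonian_isHermitian G t U
  have hmemK : ∀ φ, φ ∈ K ↔ IsNParticle (p + q) φ ∧ spinSq *ᵥ φ = l • φ := by
    intro φ
    rw [hK, Submodule.mem_inf, mem_nParticleSubmodule_iff, Module.End.mem_eigenspace_iff,
      Matrix.toLin'_apply]
  -- the sector ground state lies in `K`
  obtain ⟨ψ₀, hψ₀sec, hψ₀0, hHψ₀, -⟩ :=
    hubbard_halfFilled_upDownSector_groundState_unique G hG A hA ht hU hpq
  obtain ⟨-, hS2⟩ := hubbard_halfFilled_upDownSector_groundState_spin G hG A hA ht hU hpq hqA hqB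
    hψ₀sec hHψ₀
  have hψ₀K : ψ₀ ∈ K := (hmemK ψ₀).2 ⟨hψ₀sec.isNParticle, hS2⟩
  refine le_antisymm ?_ ?_
  · -- `E_min(S) ≤ E(p,q)`: Rayleigh quotient of the normalised `ψ₀`
    obtain ⟨c, -, hc1⟩ := Literature.MathematicalPhysics.QuantumLattice.exists_smul_unit hψ₀0
    have hmem : c • ψ₀ ∈ K := K.smul_mem c hψ₀K
    have hray : (star (c • ψ₀) ⬝ᵥ H *ᵥ (c • ψ₀)).re = E := by
      rw [mulVec_smul, hHψ₀, smul_comm, dotProduct_smul, hc1, smul_eq_mul, mul_one, Complex.ofReal_re]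
    rw [← hray]
    refine csInf_le ⟨H.groundEnergy, ?_⟩ ⟨c • ψ₀, hmem, hc1, rfl⟩
    rintro e ⟨φ, -, hφ1, rfl⟩
    exact Matrix.groundEnergy_le_rayleigh_holds hHerm φ hφ1
  · -- `E(p,q) ≤ E_min(S)`: the raising argument on every unit vector of `K`
    refine le_csInf ?_ ?_
    · obtain ⟨c, -, hc1⟩ := Literature.MathematicalPhysics.QuantumLattice.exists_smul_unit hψ₀0
      exact ⟨_, c • ψ₀, K.smul_mem c hψ₀K, hc1, rfl⟩
    · rintro e ⟨φ, hφK, hφ1, rfl⟩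
      obtain ⟨hφN, hφC⟩ := (hmemK φ).1 hφK
      have h := minEnergyOn_szSector_mul_le_re_expect_of_spinSq hHerm
        (LiebThm1.preservesSectors_hamiltonian G t U) (LiebThm1.hamiltonian_commute_spinMinus G t U)
        hqp (by omega) hφN hφC
      rwa [hφ1, Complex.one_re, mul_one] at h

/-- **Tasaki's inequality `E_min(S) < E_min(S + 1)` for the half-filled Hubbard model**
(J. Phys.: Condens. Matter 10 (1998) 4353, §5, the display after Theorem 5.2): for `G` connected and
bipartite with colour class `A`, `t ≠ 0`, `U > 0`, `N = |Λ|`, and every `S` with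
`||A| - |Aᶜ||/2 ≤ S ≤ |Λ|/2 - 1` — realised as `S = (p - q)/2`, `p + q = |Λ|`, `1 ≤ q ≤ |A|, |Aᶜ|` —
the lowest energy among `N`-electron states of total spin `S` is strictly below that of total spin
`S + 1`: `E_min(S) < E_min(S+1)`, `E_min(S) = H.minEnergyOn (nParticleSubmodule |Λ| ⊓ eigenspace S²
(S(S+1)))`. [cite: Tasaki1998, §5] -/
theorem hubbard_halfFilled_minEnergyOn_spinSq_lt_succ (hG : G.Connected) (A : Finset Λ)
    (hA : ∀ x y : Λ, G.Adj x y → (x ∈ A ↔ y ∉ A)) {t U : ℝ} (ht : t ≠ 0) (hU : 0 < U)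
    {S : ℝ} (p q : ℕ) (hpq : p + q = Fintype.card Λ) (hS : ((p : ℝ) - q) / 2 = S)
    (hq : 1 ≤ q) (hqA : q ≤ A.card) (hqB : q ≤ Aᶜ.card) :
    (hamiltonian G t U).minEnergyOn
        (nParticleSubmodule (ι := Orb Λ) (Fintype.card Λ) ⊓
          Module.End.eigenspace (Matrix.toLin' (spinSq : Matrix (Finset (Orb Λ)) _ ℂ))
            (((S * (S + 1)) : ℝ) : ℂ)) <
      (hamiltonian G t U).minEnergyOn
        (nParticleSubmodule (ι := Orb Λ) (Fintype.card Λ) ⊓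
          Module.End.eigenspace (Matrix.toLin' (spinSq : Matrix (Finset (Orb Λ)) _ ℂ))
            ((((S + 1) * (S + 1 + 1)) : ℝ) : ℂ)) := by
  obtain ⟨q', rfl⟩ : ∃ q', q = q' + 1 := ⟨q - 1, by omega⟩
  have h1 := hubbard_halfFilled_minEnergyOn_spinSq_eq G hG A hA ht hU hpq hqA hqB
  have h2 := hubbard_halfFilled_minEnergyOn_spinSq_eq G hG A hA ht hU (p := p + 1) (q := q')
    (by omega) (by omega) (by omega)
  have hlt := hubbard_halfFilled_minEnergyOn_upDownSector_lt G hG A hA ht hU (p := p) (q := q')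
    hpq hqA hqB
  have e1 : (((p + 1 : ℕ) : ℝ) - q') / 2 = S + 1 := by rw [← hS]; push_cast; ring
  have e2 : p + 1 + q' = Fintype.card Λ := by omega
  rw [hpq, hS] at h1
  rw [e2, e1] at h2
  rw [hpq, hS, e2, e1, ← h1, ← h2] at hlt
  exact hlt

/-- **Balanced case of Tasaki's inequality** (`|Aᶜ| = |A| = n`, `|Λ| = 2n`): `E_min(S) < E_min(S+1)`
for every natural `S` with `S + 1 ≤ n`; in particular the first excitation above the unique singlet
ground state among states of nonzero total spin is a triplet level: `E_min(0) < E_min(1) < E_min(2)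
< ⋯`. [cite: Tasaki1998, §5] -/
theorem hubbard_halfFilled_balanced_minEnergyOn_spinSq_lt_succ (hG : G.Connected) (A : Finset Λ)
    (hA : ∀ x y : Λ, G.Adj x y → (x ∈ A ↔ y ∉ A)) (hcard : Aᶜ.card = A.card)
    {t U : ℝ} (ht : t ≠ 0) (hU : 0 < U) {S : ℕ} (hS : S + 1 ≤ A.card) :
    (hamiltonian G t U).minEnergyOn
        (nParticleSubmodule (ι := Orb Λ) (Fintype.card Λ) ⊓
          Module.End.eigenspace (Matrix.toLin' (spinSq : Matrix (Finset (Orb Λ)) _ ℂ))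
            ((((S : ℝ) * (S + 1)) : ℝ) : ℂ)) <
      (hamiltonian G t U).minEnergyOn
        (nParticleSubmodule (ι := Orb Λ) (Fintype.card Λ) ⊓
          Module.End.eigenspace (Matrix.toLin' (spinSq : Matrix (Finset (Orb Λ)) _ ℂ))
            (((((S : ℝ) + 1) * ((S : ℝ) + 1 + 1)) : ℝ) : ℂ)) := by
  have hAB := Finset.card_add_card_compl A
  exact hubbard_halfFilled_minEnergyOn_spinSq_lt_succ G hG A hA ht hU (A.card + S) (A.card - S)
    (by omega) (by rw [Nat.cast_sub (by omega)]; push_cast; ring) (by omega) (by omega) (by omega)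

end EminOrdering

section TorusEmin

open Literature.Probability.LatticeModels

variable {L : ℕ} [NeZero L]

/-- **Tasaki's inequality on the even square torus**: for even `L ≠ 0`, `t ≠ 0`, `U > 0` and every
natural `S` with `2(S + 1) ≤ L²`, the lowest energy among `L²`-electron (half-filled) states of
total spin `S` of `hamiltonian (fermionTorusGraph 2 L) t U` is strictly below that of total spin
`S + 1`: `E_min(0) < E_min(1) < E_min(2) < ⋯`. [cite: Tasaki1998, §5] -/
theorem hubbardTorus_minEnergyOn_spinSq_lt_succ (hL : Even L) {t U : ℝ} (ht : t ≠ 0) (hU : 0 < U)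
    {S : ℕ} (hS : 2 * (S + 1) ≤ L ^ 2) :
    (hamiltonian (fermionTorusGraph 2 L) t U).minEnergyOn
        (nParticleSubmodule (ι := Orb (FermionTorus 2 L)) (L ^ 2) ⊓
          Module.End.eigenspace
            (Matrix.toLin' (spinSq : Matrix (Finset (Orb (FermionTorus 2 L))) _ ℂ))
            ((((S : ℝ) * (S + 1)) : ℝ) : ℂ)) <
      (hamiltonian (fermionTorusGraph 2 L) t U).minEnergyOn
        (nParticleSubmodule (ι := Orb (FermionTorus 2 L)) (L ^ 2) ⊓
          Module.End.eigenspace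
            (Matrix.toLin' (spinSq : Matrix (Finset (Orb (FermionTorus 2 L))) _ ℂ))
            (((((S : ℝ) + 1) * ((S : ℝ) + 1 + 1)) : ℝ) : ℂ)) := by
  obtain ⟨hG, hA, h2, -⟩ := LiebHalfFilled.hubbardTorus_lieb_hypotheses (L := L) hL
  have hcard := LiebHalfFilled.compl_card_eq_card_of_two_mul h2
  rw [card_fermionTorus_two''] at h2
  have h := hubbard_halfFilled_balanced_minEnergyOn_spinSq_lt_succ (fermionTorusGraph 2 L) hG _ hA
    hcard ht hU (S := S) (by omega)
  rw [card_fermionTorus_two''] at h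
  convert h using 6

end TorusEmin

end Literature.MathematicalPhysics.QuantumLattice
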